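import Literature.Combinatorics.SimpleGraph.LasserreStableBound
import Mathlib.Data.Finset.Interval
import HarnessLib

/-!
# Finite convergence of Lasserre's hierarchy for the stability number: `las⁽ᵗ⁾(G) = α(G)` for `t ≥ α(G)`

M. Laurent, *Strengthened semidefinite programming bounds for codes*, Math. Program. 109 (2007)
239–261, §3.1 p. 248 (PDF p. 10 of the held text, read 2026-08-15): after program (22)
`las⁽ᵏ⁾(G) := max Σ_{i∈V} y_i s.t. M_k(y) ⪰ 0, y_∅ = 1, y_{ij} = 0 (ij ∈ E)` —
"Then, `α(G) ≤ las⁽ᵏ⁾(G)`, with equality if `k ≥ α(G)` ([7, 8])", where [7] = J. B. Lasserre, *An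
explicit exact SDP relaxation for nonlinear 0–1 programs* (IPCO 2001) and [8] = M. Laurent, *A
comparison of the Sherali–Adams, Lovász–Schrijver and Lasserre relaxations for 0–1 programming*,
Math. Oper. Res. 28 (2003) (`Laurent2003`; its proof, §3.1 Lemma 2 (ii) and §6.1 Prop. 21, pp. 6
and 17 of the held text, was re-read 2026-08-15 for the discharge at the end of this file).

The sibling file `LasserreStableBound.lean` PROVES the inequality `α(G) ≤ las⁽ᵗ⁾(G)`
(`indepNum_le_lasserreStableBound`) and defers the equality ("finite convergence … (Laurent 2003)
— separate file"). This file vendors the equality half as a NAMED FACT, in the pointwise form in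
which it is used (every level-`t` feasible moment vector has value `≤ α(G)` once `t ≥ α(G)`), and
DISCHARGES it (`Laurent2003_lasserre_exact_of_indepNum_le_holds`, last section: Möbius inversion
on the Boolean lattice and `M_t(y) ⪰ 0 ⇒ Z⁻¹y ≥ 0`, Laurent 2003 §3.1 Lemma 2 (ii), §6.1 Prop. 21).

## What is vendored

* `Laurent2003_lasserre_exact_of_indepNum_le` — the named fact: for every finite graph `G` and
  `t ≥ α(G)`, every `y` feasible for (22) at level `t` has `Σ_v y_{v} ≤ α(G)`.
* Proved consequences: `lasserreStableBound_eq_indepNum` (`las⁽ᵗ⁾(G) = α(G)` for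
  `max 1 α(G) ≤ t`, using the proved soundness), the nonnegative variant, and the inline
  route-shaped form `sum_singleton_le_indepNum_of_inline` (hypotheses exactly as the route
  `PneNP/DelsarteLasserre` item `LasserreFiniteConvergence` spells them — the extra `y ≥ 0` is
  simply dropped).

Users take `(h : Laurent2003_lasserre_exact_of_indepNum_le)` and are fed `…_holds`.

## Tree search

`lean search 'lasserre|Lasserre'` (Mathlib + Literature): only the two sibling files
`LasserreStableBound.lean` / `LasserreLevelOne.lean` (no finite-convergence statement) and the route
file `Summits/PneNP/PneNP/Theses/DelsarteLasserre.lean`.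
-/

namespace Literature.Combinatorics.SimpleGraph

open Matrix Finset

/-- **Laurent 2003 §5 / Laurent 2006 p. 248 — named fact (finite convergence of Lasserre's
hierarchy for stable sets).** "`α(G) ≤ las⁽ᵏ⁾(G)`, with equality if `k ≥ α(G)`": for a finite
graph `G` and a level `t ≥ α(G)`, every moment vector `y` feasible for program (22) at level `t`
(`y_∅ = 1`, `y_{uv} = 0` on edges, `M_t(y) ⪰ 0`) satisfies `Σ_{v} y_{v} ≤ α(G)`.
[cite: Laurent2006, §3.1 p. 248 (after (22)); Laurent2003 §5] -/
def Laurent2003_lasserre_exact_of_indepNum_le : Prop :=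
  ∀ (V : Type) [Fintype V] [DecidableEq V] (G : SimpleGraph V) (t : ℕ),
    G.indepNum ≤ t → ∀ y : Finset V → ℝ, IsLasserreFeasible G t y → ∑ v, y {v} ≤ (G.indepNum : ℝ)

variable {V : Type} [Fintype V] [DecidableEq V]

/-- `las⁽ᵗ⁾(G) = α(G)` for `t ≥ max 1 α(G)`, from the fact and the proved soundness
`indepNum_le_lasserreStableBound`. (`t ≥ 1` is needed on the `≥` side: level `0` is the junk
value `0`.) [cite: Laurent2006, §3.1 p. 248] -/
theorem lasserreStableBound_eq_indepNum (h : Laurent2003_lasserre_exact_of_indepNum_le)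
    (G : SimpleGraph V) {t : ℕ} (ht : 1 ≤ t) (hα : G.indepNum ≤ t) :
    lasserreStableBound G t = (G.indepNum : ℝ) :=
  le_antisymm (lasserreStableBound_le_of_forall (h V G t hα))
    (indepNum_le_lasserreStableBound G t ht)

/-- The nonnegative variant (`ϑ′`-type hierarchy) is squeezed to `α(G)` as well. [cite: Laurent2006, §3.1 p. 248] -/
theorem nonnegLasserreStableBound_eq_indepNum (h : Laurent2003_lasserre_exact_of_indepNum_le)
    (G : SimpleGraph V) {t : ℕ} (ht : 1 ≤ t) (hα : G.indepNum ≤ t) :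
    nonnegLasserreStableBound G t = (G.indepNum : ℝ) :=
  le_antisymm
    (nonnegLasserreStableBound_le_of_forall fun y hy => h V G t hα y hy.toIsLasserreFeasible)
    (indepNum_le_nonnegLasserreStableBound G t ht)

/-- Route-shaped form (the hypotheses of `PneNP/DelsarteLasserre.LasserreFiniteConvergence` for an
arbitrary finite graph presented as `SimpleGraph.fromRel r`): given the fact, if `α(G) ≤ t` then
every `y` with `y ∅ = 1`, `y ≥ 0`, `y {u,v} = 0` whenever `u ≠ v ∧ r u v`, and PSD inline moment
matrix has `Σ_v y {v} ≤ α(G)`. [folklore] -/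
theorem sum_singleton_le_indepNum_of_inline (h : Laurent2003_lasserre_exact_of_indepNum_le)
    (r : V → V → Prop) (t : ℕ) (hα : (SimpleGraph.fromRel r).indepNum ≤ t) (y : Finset V → ℝ)
    (h0 : y ∅ = 1) (_hnn : ∀ S, 0 ≤ y S) (hE : ∀ u v : V, u ≠ v → r u v → y {u, v} = 0)
    (hpsd : (Matrix.of fun I J : {S : Finset V // S.card ≤ t} => y (I.1 ∪ J.1)).PosSemidef) :
    ∑ v, y {v} ≤ ((SimpleGraph.fromRel r).indepNum : ℝ) := by
  refine h V (SimpleGraph.fromRel r) t hα y ((isLasserreFeasible_iff _ t y).2 ⟨h0, ?_, hpsd⟩)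
  exact (forall_fromRel_adj_pair_eq_zero_iff r y).2 hE

/-! ### Proof of the fact (Laurent 2003, §3.1 Lemma 2 (ii) and §6.1 Proposition 21)

We follow the printed proof (M. Laurent, Math. Oper. Res. 28 (2003), read 2026-08-15 from the
held text: (11) p. 5, Lemma 2 p. 6, Lemma 20 and Proposition 21 p. 17). Let `α(G) ≤ t` and let
`y` be feasible for (22) at level `t`.
* (Lemma 20 (ii) ⇒ (iii) = `IsLasserreFeasible.apply_eq_zero_of_not_isIndepSet` of the sibling
  file) `y_U = 0` for every non-stable `U` with `|U| ≤ 2t`, in particular for `α(G) < |U| ≤ 2t`.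
* (Proposition 21) Extend `y|_{P_t(V)}` by zero: `z_U := y_U` if `|U| ≤ t`, else `0`. Then the
  full moment matrix `M_V(z) = (z_{I∪J})_{I,J ⊆ V}` equals `M_t(y) ⊕ 0`, hence its quadratic
  form is that of `M_t(y) ⪰ 0` (`z_{I∪J} = y_{I∪J}` for `|I|, |J| ≤ t`, both sides vanishing when
  `|I ∪ J| > t ≥ α(G)`).
* ((11) and Lemma 2 (ii): "`M_V(y) ⪰ 0 ⟺ Z⁻¹y ≥ 0`") With the Möbius transform
  `λ_T := Σ_{T' ⊇ T} (-1)^{|T'∖T|} z_{T'}` one has `z = Zλ`, i.e. `z_K = Σ_{T ⊇ K} λ_T`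
  (`sum_ite_subset_moebius_eq`), and `M_V(z) = Z diag(λ) Zᵀ`, written here as the identity of
  quadratic forms `Σ_{I,J} x_I z_{I∪J} x_J = Σ_T λ_T (Σ_{I ⊆ T} x_I)²`
  (`sum_sum_mul_apply_union_mul_eq`). Testing against the Möbius vector
  `x_S := ((-1)^{|I∖S|} [S ⊆ I])_I`, for which `Σ_{I ⊆ T} x_S(I) = [S = T]`, gives
  `λ_S = x_Sᵀ M_V(z) x_S ≥ 0`.
* `λ_T = 0` whenever `|T| > α(G)` (every `z_{T'}`, `T' ⊇ T`, vanishes), so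
  `Σ_v y_v = Σ_T |T| λ_T ≤ α(G) Σ_T λ_T = α(G) z_∅ = α(G)`.

Only finite sums over the Boolean lattice `Finset V` are used; the one passage through the
index type `{S // |S| ≤ t}` of `momentMatrix` is the positivity step. -/

section FiniteConvergenceProof

variable {W : Type*} [Fintype W] [DecidableEq W]

/-- Alternating sums over an interval of the Boolean lattice:
`Σ_{S ⊆ I ⊆ T} (-1)^{|I|} = (-1)^{|S|} [S = T]` (the Möbius function of `P(V)`,
Laurent 2003 (11): "`Z⁻¹_{I,J} = (-1)^{|J∖I|}` if `I ⊆ J`, `0` otherwise"). [folklore] -/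
theorem sum_ite_subset_subset_neg_one_pow_card (S T : Finset W) :
    (∑ I : Finset W, if S ⊆ I ∧ I ⊆ T then (-1 : ℝ) ^ I.card else 0) =
      if S = T then (-1 : ℝ) ^ S.card else 0 := by
  rw [← Finset.sum_filter]
  have hfilter : (univ.filter fun I : Finset W => S ⊆ I ∧ I ⊆ T) = Finset.Icc S T := by
    ext I
    simp
  rw [hfilter]
  by_cases hST : S ⊆ T
  · rw [Finset.Icc_eq_image_powerset hST, Finset.sum_image]
    · have hU : ∀ U ∈ (T \ S).powerset,
          (-1 : ℝ) ^ (S ∪ U).card = (-1 : ℝ) ^ S.card * ((-1 : ℤ) ^ U.card : ℤ) := by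
        intro U hU
        have hdisj : Disjoint S U :=
          Finset.disjoint_of_subset_right (Finset.mem_powerset.1 hU) Finset.disjoint_sdiff
        rw [card_union_of_disjoint hdisj, pow_add]
        push_cast
        rfl
      rw [Finset.sum_congr rfl hU, ← Finset.mul_sum, ← Int.cast_sum,
        Finset.sum_powerset_neg_one_pow_card]
      by_cases h : S = T
      · subst h
        simp
      · have hne : T \ S ≠ ∅ := fun h' =>
          h (Finset.Subset.antisymm hST (Finset.sdiff_eq_empty_iff_subset.1 h'))
        simp [hne, h]
    · intro U₁ hU₁ U₂ hU₂ hU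
      have h₁ : Disjoint S U₁ :=
        Finset.disjoint_of_subset_right (Finset.mem_powerset.1 hU₁) Finset.disjoint_sdiff
      have h₂ : Disjoint S U₂ :=
        Finset.disjoint_of_subset_right (Finset.mem_powerset.1 hU₂) Finset.disjoint_sdiff
      rw [← Finset.union_sdiff_cancel_left h₁, ← Finset.union_sdiff_cancel_left h₂]
      exact congrArg (· \ S) hU
  · rw [Finset.Icc_eq_empty_iff.2 hST, Finset.sum_empty, if_neg]
    rintro rfl
    exact hST Finset.Subset.rfl

/-- **Möbius inversion on the Boolean lattice** (upward form): with the Möbius transform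
`λ_T := Σ_{T' ⊇ T} (-1)^{|T'|+|T|} z_{T'}` one has `z_K = Σ_{T ⊇ K} λ_T` for every `K`, i.e.
`z = Z (Z⁻¹ z)` for the zeta matrix `Z_{I,J} = [I ⊆ J]` of `P(V)` (Laurent 2003, §3.1 (11)).
[cite: Laurent2003, §3.1 (11)] -/
theorem sum_ite_subset_moebius_eq (z : Finset W → ℝ) (K : Finset W) :
    (∑ T : Finset W, if K ⊆ T then
        ∑ T' : Finset W, (if T ⊆ T' then (-1 : ℝ) ^ (T'.card + T.card) * z T' else 0) else 0) =
      z K := by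
  have hsq : (-1 : ℝ) ^ K.card * (-1 : ℝ) ^ K.card = 1 := by
    rw [← pow_add, Even.neg_one_pow ⟨K.card, rfl⟩]
  calc (∑ T : Finset W, if K ⊆ T then
          ∑ T' : Finset W, (if T ⊆ T' then (-1 : ℝ) ^ (T'.card + T.card) * z T' else 0) else 0)
      = ∑ T : Finset W, ∑ T' : Finset W,
          (if K ⊆ T ∧ T ⊆ T' then (-1 : ℝ) ^ (T'.card + T.card) * z T' else 0) := by
        refine Finset.sum_congr rfl fun T _ => ?_
        by_cases hKT : K ⊆ T
        · rw [if_pos hKT]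
          exact Finset.sum_congr rfl fun T' _ => by rw [if_congr (and_iff_right hKT).symm rfl rfl]
        · rw [if_neg hKT]
          exact (Finset.sum_eq_zero fun T' _ => if_neg fun h => hKT h.1).symm
    _ = ∑ T' : Finset W, ∑ T : Finset W,
          (if K ⊆ T ∧ T ⊆ T' then (-1 : ℝ) ^ (T'.card + T.card) * z T' else 0) :=
        Finset.sum_comm
    _ = ∑ T' : Finset W, (-1 : ℝ) ^ T'.card * z T' *
          ∑ T : Finset W, (if K ⊆ T ∧ T ⊆ T' then (-1 : ℝ) ^ T.card else 0) := by
        refine Finset.sum_congr rfl fun T' _ => ?_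
        rw [Finset.mul_sum]
        refine Finset.sum_congr rfl fun T _ => ?_
        by_cases h : K ⊆ T ∧ T ⊆ T'
        · rw [if_pos h, if_pos h, pow_add]
          ring
        · rw [if_neg h, if_neg h, mul_zero]
    _ = ∑ T' : Finset W, (-1 : ℝ) ^ T'.card * z T' *
          (if K = T' then (-1 : ℝ) ^ K.card else 0) := by
        refine Finset.sum_congr rfl fun T' _ => ?_
        rw [sum_ite_subset_subset_neg_one_pow_card]
    _ = (-1 : ℝ) ^ K.card * z K * (-1 : ℝ) ^ K.card := by
        rw [Finset.sum_eq_single K]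
        · rw [if_pos rfl]
        · intro T' _ hT'
          rw [if_neg (Ne.symm hT'), mul_zero]
        · intro h
          exact absurd (Finset.mem_univ K) h
    _ = z K := by
        rw [mul_comm, ← mul_assoc, hsq, one_mul]

/-- **`M_V(z) = Z diag(λ) Zᵀ`** as an identity of quadratic forms (Laurent 2003, proof of
Lemma 2: "`Z D_u Zᵀ = M_V(g ∗ y)`", here with `g = 1`): if `z_K = Σ_{T ⊇ K} λ_T` for all `K`,
then `Σ_{I,J} x_I z_{I∪J} x_J = Σ_T λ_T (Σ_{I ⊆ T} x_I)²` for every vector `x`.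
[cite: Laurent2003, §3.1 Lemma 2] -/
theorem sum_sum_mul_apply_union_mul_eq (z x lam : Finset W → ℝ)
    (hz : ∀ K : Finset W, z K = ∑ T : Finset W, if K ⊆ T then lam T else 0) :
    (∑ I : Finset W, ∑ J : Finset W, x I * z (I ∪ J) * x J) =
      ∑ T : Finset W, lam T * (∑ I : Finset W, if I ⊆ T then x I else 0) ^ 2 := by
  calc (∑ I : Finset W, ∑ J : Finset W, x I * z (I ∪ J) * x J)
      = ∑ I : Finset W, ∑ J : Finset W, ∑ T : Finset W,
          lam T * ((if I ⊆ T then x I else 0) * (if J ⊆ T then x J else 0)) := by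
        refine Finset.sum_congr rfl fun I _ => Finset.sum_congr rfl fun J _ => ?_
        rw [hz (I ∪ J), Finset.mul_sum, Finset.sum_mul]
        refine Finset.sum_congr rfl fun T _ => ?_
        by_cases hI : I ⊆ T
        · by_cases hJ : J ⊆ T
          · rw [if_pos (Finset.union_subset hI hJ), if_pos hI, if_pos hJ]
            ring
          · rw [if_neg (fun h => hJ (Finset.union_subset_iff.1 h).2), if_neg hJ]
            ring
        · rw [if_neg (fun h => hI (Finset.union_subset_iff.1 h).1), if_neg hI]
          ring
    _ = ∑ I : Finset W, ∑ T : Finset W, ∑ J : Finset W,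
          lam T * ((if I ⊆ T then x I else 0) * (if J ⊆ T then x J else 0)) :=
        Finset.sum_congr rfl fun I _ => Finset.sum_comm
    _ = ∑ T : Finset W, ∑ I : Finset W, ∑ J : Finset W,
          lam T * ((if I ⊆ T then x I else 0) * (if J ⊆ T then x J else 0)) :=
        Finset.sum_comm
    _ = ∑ T : Finset W, lam T * (∑ I : Finset W, if I ⊆ T then x I else 0) ^ 2 := by
        refine Finset.sum_congr rfl fun T _ => ?_
        rw [sq, Finset.sum_mul_sum, Finset.mul_sum]
        refine Finset.sum_congr rfl fun I _ => ?_
        rw [Finset.mul_sum]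

/-- The Möbius test vector `x_S := ((-1)^{|I|+|S|} [S ⊆ I])_I` is dual to the zeta columns:
`Σ_{I ⊆ T} x_S(I) = [S = T]` (row `S` of `Z⁻¹ Z = 1`, Laurent 2003 (11)). [folklore] -/
theorem sum_ite_subset_moebiusVec_eq (S T : Finset W) :
    (∑ I : Finset W, if I ⊆ T then
        (if S ⊆ I then (-1 : ℝ) ^ (I.card + S.card) else 0) else 0) =
      if S = T then (1 : ℝ) else 0 := by
  calc (∑ I : Finset W, if I ⊆ T then
          (if S ⊆ I then (-1 : ℝ) ^ (I.card + S.card) else 0) else 0)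
      = (-1 : ℝ) ^ S.card *
          ∑ I : Finset W, (if S ⊆ I ∧ I ⊆ T then (-1 : ℝ) ^ I.card else 0) := by
        rw [Finset.mul_sum]
        refine Finset.sum_congr rfl fun I _ => ?_
        by_cases hIT : I ⊆ T
        · by_cases hSI : S ⊆ I
          · rw [if_pos hIT, if_pos hSI, if_pos ⟨hSI, hIT⟩, pow_add, mul_comm]
          · rw [if_pos hIT, if_neg hSI, if_neg (fun h => hSI h.1), mul_zero]
        · rw [if_neg hIT, if_neg (fun h => hIT h.2), mul_zero]
    _ = if S = T then (1 : ℝ) else 0 := by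
        rw [sum_ite_subset_subset_neg_one_pow_card]
        by_cases h : S = T
        · rw [if_pos h, if_pos h, ← pow_add, Even.neg_one_pow ⟨S.card, rfl⟩]
        · rw [if_neg h, if_neg h, mul_zero]

end FiniteConvergenceProof

/-- **Discharge of the named fact** (Laurent 2003, Proposition 21 with Lemma 2 (ii); quoted by
Laurent 2006, p. 248: "`α(G) ≤ las⁽ᵏ⁾(G)`, with equality if `k ≥ α(G)`"): for `t ≥ α(G)` every
`y` feasible for (22) at level `t` has `Σ_v y_v ≤ α(G)`. Proof: Möbius inversion of the
zero-extension `z` of `y|_{P_t(V)}`, whose Möbius coefficients `λ_T` are `≥ 0` (from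
`M_t(y) ⪰ 0`), vanish for `|T| > α(G)`, and sum to `z_∅ = 1`; see the section docstring above.
[cite: Laurent2003, §6.1 Prop. 21 and §3.1 Lemma 2 (ii); Laurent2006, §3.1 p. 248] -/
theorem Laurent2003_lasserre_exact_of_indepNum_le_holds :
    Laurent2003_lasserre_exact_of_indepNum_le := by
  intro V _ _ G t hα y hy
  -- Lemma 20 (ii) ⇒ (iii): `y` vanishes on the sets `U` with `α(G) < |U| ≤ 2t` (all non-stable).
  have hzero : ∀ U : Finset V, G.indepNum < U.card → U.card ≤ 2 * t → y U = 0 :=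
    fun U hU hU2 => hy.apply_eq_zero_of_not_isIndepSet hU2
      fun hind => (not_le.2 hU) hind.card_le_indepNum
  -- Proposition 21: the zero-extension `z` of `y|_{P_t(V)}`.
  obtain ⟨z, hz⟩ : ∃ z : Finset V → ℝ, ∀ U, z U = if U.card ≤ t then y U else 0 :=
    ⟨_, fun _ => rfl⟩
  have hz_gt : ∀ U : Finset V, ¬ U.card ≤ t → z U = 0 := fun U hU => by rw [hz U, if_neg hU]
  have hz_large : ∀ U : Finset V, G.indepNum < U.card → z U = 0 := by
    intro U hU
    rw [hz U]
    split_ifs with hUt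
    · exact hzero U hU (by omega)
    · rfl
  -- `M_V(z) = M_t(y) ⊕ 0`: the entries over `P_t(V) × P_t(V)` agree.
  have hz_union : ∀ I J : Finset V, I.card ≤ t → J.card ≤ t → z (I ∪ J) = y (I ∪ J) := by
    intro I J hI hJ
    rw [hz (I ∪ J)]
    split_ifs with hIJ
    · rfl
    · exact (hzero _ (hα.trans_lt (not_le.1 hIJ))
        ((Finset.card_union_le I J).trans (by omega))).symm
  -- The Möbius transform `λ = Z⁻¹ z` and Möbius inversion `z = Z λ`.
  obtain ⟨lam, hlam⟩ : ∃ lam : Finset V → ℝ, ∀ T, lam T =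
      ∑ T' : Finset V, (if T ⊆ T' then (-1 : ℝ) ^ (T'.card + T.card) * z T' else 0) :=
    ⟨_, fun _ => rfl⟩
  have hmob : ∀ K : Finset V, z K = ∑ T : Finset V, if K ⊆ T then lam T else 0 := by
    intro K
    simp_rw [hlam]
    exact (sum_ite_subset_moebius_eq z K).symm
  -- `λ_T = 0` for `|T| > α(G)`.
  have hlam_zero : ∀ T : Finset V, G.indepNum < T.card → lam T = 0 := by
    intro T hT
    rw [hlam T]
    refine Finset.sum_eq_zero fun T' _ => ?_
    split_ifs with hTT'
    · rw [hz_large T' (hT.trans_le (Finset.card_le_card hTT')), mul_zero]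
    · rfl
  -- Lemma 2 (ii): `λ_S = x_Sᵀ M_V(z) x_S ≥ 0`, the quadratic form being that of `M_t(y) ⪰ 0`.
  have hlam_nonneg : ∀ S : Finset V, 0 ≤ lam S := by
    intro S
    obtain ⟨xS, hxS⟩ : ∃ xS : Finset V → ℝ, ∀ I,
        xS I = if S ⊆ I then (-1 : ℝ) ^ (I.card + S.card) else 0 := ⟨_, fun _ => rfl⟩
    have hquad := sum_sum_mul_apply_union_mul_eq z xS lam hmob
    have hinner : ∀ T : Finset V,
        (∑ I : Finset V, if I ⊆ T then xS I else 0) = if S = T then (1 : ℝ) else 0 := by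
      intro T
      simp_rw [hxS]
      exact sum_ite_subset_moebiusVec_eq S T
    simp_rw [hinner] at hquad
    have hval : (∑ T : Finset V, lam T * (if S = T then (1 : ℝ) else 0) ^ 2) = lam S := by
      rw [Finset.sum_eq_single S]
      · rw [if_pos rfl, one_pow, mul_one]
      · intro T _ hTS
        rw [if_neg (Ne.symm hTS), zero_pow two_ne_zero, mul_zero]
      · intro h
        exact absurd (Finset.mem_univ S) h
    -- `λ_S = Σ_{I,J} x_S(I) z_{I∪J} x_S(J)` is the quadratic form of `M_t(y)` at `x_S|_{P_t(V)}`
    have hP : ∀ U : Finset V, U ∈ (univ.filter fun S : Finset V => S.card ≤ t) ↔ U.card ≤ t :=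
      fun U => by simp
    have hconv : (∑ I : Finset V, ∑ J : Finset V, xS I * z (I ∪ J) * xS J) =
        ∑ I : {S : Finset V // S.card ≤ t}, ∑ J : {S : Finset V // S.card ≤ t},
          xS I.1 * y (I.1 ∪ J.1) * xS J.1 := by
      calc (∑ I : Finset V, ∑ J : Finset V, xS I * z (I ∪ J) * xS J)
          = ∑ I ∈ univ.filter (fun S : Finset V => S.card ≤ t),
              ∑ J : Finset V, xS I * z (I ∪ J) * xS J := by
            refine (Finset.sum_filter_of_ne fun I _ hne => ?_).symm
            by_contra hI
            refine hne (Finset.sum_eq_zero fun J _ => ?_)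
            rw [hz_gt (I ∪ J) fun h => hI ((Finset.card_le_card Finset.subset_union_left).trans h),
              mul_zero, zero_mul]
        _ = ∑ I : {S : Finset V // S.card ≤ t}, ∑ J : Finset V, xS I.1 * z (I.1 ∪ J) * xS J :=
            Finset.sum_subtype _ hP fun I : Finset V => ∑ J : Finset V, xS I * z (I ∪ J) * xS J
        _ = ∑ I : {S : Finset V // S.card ≤ t}, ∑ J ∈ univ.filter (fun S : Finset V => S.card ≤ t),
              xS I.1 * z (I.1 ∪ J) * xS J := by
            refine Finset.sum_congr rfl fun I _ => (Finset.sum_filter_of_ne fun J _ hne => ?_).symm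
            by_contra hJ
            refine hne ?_
            rw [hz_gt (I.1 ∪ J) fun h => hJ ((Finset.card_le_card Finset.subset_union_right).trans h),
              mul_zero, zero_mul]
        _ = ∑ I : {S : Finset V // S.card ≤ t}, ∑ J : {S : Finset V // S.card ≤ t},
              xS I.1 * z (I.1 ∪ J.1) * xS J.1 :=
            Finset.sum_congr rfl fun I _ =>
              Finset.sum_subtype _ hP fun J : Finset V => xS I.1 * z (I.1 ∪ J) * xS J
        _ = ∑ I : {S : Finset V // S.card ≤ t}, ∑ J : {S : Finset V // S.card ≤ t},
              xS I.1 * y (I.1 ∪ J.1) * xS J.1 :=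
            Finset.sum_congr rfl fun I _ => Finset.sum_congr rfl fun J _ => by
              rw [hz_union I.1 J.1 I.2 J.2]
    have hpsd := hy.posSemidef.dotProduct_mulVec_nonneg
      (fun I : {S : Finset V // S.card ≤ t} => xS I.1)
    rw [star_trivial] at hpsd
    have hform : (fun I : {S : Finset V // S.card ≤ t} => xS I.1) ⬝ᵥ
        (momentMatrix t y *ᵥ fun I : {S : Finset V // S.card ≤ t} => xS I.1) =
        ∑ I : {S : Finset V // S.card ≤ t}, ∑ J : {S : Finset V // S.card ≤ t},
          xS I.1 * y (I.1 ∪ J.1) * xS J.1 := by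
      simp only [dotProduct, Matrix.mulVec, momentMatrix_apply, Finset.mul_sum]
      refine Finset.sum_congr rfl fun I _ => Finset.sum_congr rfl fun J _ => ?_
      ring
    rw [← hval, ← hquad, hconv, ← hform]
    exact hpsd
  -- `Σ_T λ_T = z_∅ = y_∅ = 1`.
  have hsum_lam : ∑ T : Finset V, lam T = 1 := by
    have h := hmob ∅
    rw [hz ∅, if_pos (by simp), hy.empty_eq_one] at h
    rw [h]
    exact (Finset.sum_congr rfl fun T _ => if_pos (Finset.empty_subset T)).symm
  -- `y_v = z_v = Σ_{T ∋ v} λ_T` (here `1 ≤ t` because `{v}` is stable, so `1 ≤ α(G) ≤ t`).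
  have hyv : ∀ v : V, y {v} = ∑ T : Finset V, if v ∈ T then lam T else 0 := by
    intro v
    have hind : G.IsIndepSet ((({v} : Finset V)) : Set V) := by
      rw [Finset.coe_singleton]
      exact Set.pairwise_singleton v _
    have h1 : ({v} : Finset V).card ≤ t := hind.card_le_indepNum.trans hα
    have h := hmob {v}
    rw [hz {v}, if_pos h1] at h
    rw [h]
    exact Finset.sum_congr rfl fun T _ => if_congr Finset.singleton_subset_iff rfl rfl
  -- `Σ_v y_v = Σ_T |T| λ_T ≤ α(G) Σ_T λ_T = α(G)`.
  calc ∑ v, y {v} = ∑ v, ∑ T : Finset V, if v ∈ T then lam T else 0 :=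
        Finset.sum_congr rfl fun v _ => hyv v
    _ = ∑ T : Finset V, ∑ v, if v ∈ T then lam T else 0 := Finset.sum_comm
    _ = ∑ T : Finset V, (T.card : ℝ) * lam T := by
        refine Finset.sum_congr rfl fun T _ => ?_
        rw [Finset.sum_ite_mem, Finset.univ_inter, Finset.sum_const, nsmul_eq_mul]
    _ ≤ ∑ T : Finset V, (G.indepNum : ℝ) * lam T := by
        refine Finset.sum_le_sum fun T _ => ?_
        by_cases hT : T.card ≤ G.indepNum
        · exact mul_le_mul_of_nonneg_right (Nat.cast_le.2 hT) (hlam_nonneg T)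
        · rw [hlam_zero T (not_le.1 hT), mul_zero, mul_zero]
    _ = (G.indepNum : ℝ) := by rw [← Finset.mul_sum, hsum_lam, mul_one]

end Literature.Combinatorics.SimpleGraph
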